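import Summits.CriticalPhenomena.PercolationContinuityZ3.Theorems.QuantitativeBGN.Negative.LoadBearing
import Literature.Probability.Percolation.MinOpenCut
import Literature.Probability.Percolation.LatticeSymmetry
import Literature.Probability.Percolation.RSW
import HarnessLib

/-!
# `PercBudgetLadder.ZhangBase` (stmt-CriticalPhenomena-5251), tools: the Rossignol–Théret cutset of the
# annulus `B(n) → ∂B(2n)` and the first-moment bound on the critical min-cut budget

Helper file (`--supports stmt-CriticalPhenomena-5251`) for the proof of Zhang's base rung
`Summit.CriticalPhenomena.PercolationContinuityZ3.Theses.PercBudgetLadder.ZhangBase` (assembled in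
`Theorems/PercBudgetLadderZhangBase.lean`). Notation of the docstrings: `B(n) = box 3 n`,
`∂ⁱⁿB(n) = innerBoundary (zdGraph 3) (box 3 n)`, `J(n, r, u) = {ω | ∃ x ∈ B(n), u ↔ x in B(n + r)}`
(the event that `u` is joined to the inner box by an open path inside `B(n + r)`; written out in
full in every statement — this file introduces no definition), `N(ω) = ∑_{u ∈ ∂ⁱⁿB(n+r)} 𝟙_{J(n,r,u)}(ω)`,
`MinCut(ω) = minOpenCutIn B(2n) B(n) ∂ⁱⁿB(2n) ω` (`MinOpenCut.lean`), and
`armH r = {∃ y, ‖y‖∞ ≥ r ∧ 0 ↔ y in ℍ}` (`QuantitativeBGN/Negative/ArmLowerBound.lean`, verbatim the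
half-space one-arm event of `PercLowPointHalfSpace.QuantitativeBGN` and of this route's
`DefectDimensionOfQuantBGN`).

* `mul_measureReal_le_sum_of_indicator` — Markov's inequality for a count of occurring events.
* `real_setOf_joined_le_armH` — **symmetry bound**: `P_p(J(n, r, u)) ≤ P_p(armH r)` for
  `u ∈ ∂ⁱⁿB(n + r)`; the lattice symmetry `faceIso` (translate `u` to `0`, swap the face coordinate
  with `0`, fix the sign) maps `B(n + r)` into `ℍ`, `u` to `0` and `B(n)` to height `≥ r`, and `P_p` is
  invariant (`bondPercolation_real_preimage_relabel_iso`).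
* `exists_cutset` — **the Rossignol–Théret cutset** (RT18, Prop. 3.9, Bernoulli case, for the whole
  annulus at once): for `r + 1 ≤ n` and `ω ⊆ E(ℤ³)`, the set `T(ω)` of OPEN lattice edges `{u, v}`
  inside `B(2n)` with `ω ∈ J(n, r, u)`, `ω ∉ J(n, r, v)` satisfies (a) `|T(ω)| ≤ 6 N(ω)` — such an edge
  leaves `B(n + r)` at `u ∈ ∂ⁱⁿB(n + r)` (else the open edge would join `v` too), and `u` has `6`
  neighbours; (b) closing `T(ω)` leaves no open path inside `B(2n)` from `B(n)` to `∂ⁱⁿB(2n)` — such a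
  path runs from `B(n) ⊆ W(ω) = {u | J(n,r,u)}` to `∂ⁱⁿB(2n) ⊆ W(ω)ᶜ` (`W(ω) ⊆ B(n + r)`, `n + r < 2n`),
  so it has an open dart leaving `W(ω)` (`SimpleGraph.Walk.exists_boundary_dart`), which lies in `T(ω)`.
* `compl_setOf_minOpenCutIn_le_subset` — hence `{MinCut ≤ k}ᶜ ⊆ {(k + 1)/6 ≤ N} ∪ {ω ⊄ E(ℤ³)}`.
* `real_compl_setOf_minOpenCutIn_le` — **main estimate**, for every `p`, `k` and `r + 1 ≤ n`:
  `P_p(MinCut > k) ≤ 576 n² / (k + 1) · P_p(armH r)` (Markov, the symmetry bound and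
  `|∂ⁱⁿB(n + r)| ≤ 6 (2(n + r) + 1)² ≤ 96 n²`).

The qualitative input `P_{p_c}(armH r) → 0` (Barsky–Grimmett–Newman) is `tendsto_armH_criticalProb`
of `QuantitativeBGN/Negative/LoadBearing.lean`; it is used only in the assembly file.

## References

* R. Rossignol, M. Théret, *Existence and continuity of the flow constant in first passage
  percolation*, Electron. J. Probab. 23 (2018), Prop. 3.9 (arXiv:1707.08766) [RossignolTheret2018].
* Y. Zhang, *Critical behavior for maximal flows on the cubic lattice*, J. Stat. Phys. 98 (2000)
  [Zhang2000].
* G. Grimmett, *Percolation*, 2nd ed. (1999), §13.1 (cutsets), Thm (7.35) [GrimmettPercolation1999].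
-/

noncomputable section

namespace Summit.CriticalPhenomena.PercolationContinuityZ3.Theorems

namespace PercBudgetLadderZhangBase

open Literature.Probability.Percolation Literature.Probability.LatticeModels MeasureTheory Filter
open scoped Topology ENNReal
open Summit.CriticalPhenomena.PercolationContinuityZ3.Theorems.QuantitativeBGN.Negative
  (armH faceIso faceIso_apply_zero faceIso_apply_self)

/-! ## Markov's inequality for a count of occurring events -/

/-- **Markov's inequality for the number of occurring events**: if
`N(ω) = ∑_{u ∈ F} 𝟙_{A u}(ω)` is the number of indices `u ∈ F` with `ω ∈ A u`, then
`a · μ{a ≤ N} ≤ ∑_{u ∈ F} μ(A u)` (`a ≥ 0`; first-moment bound via `∫ N dμ = ∑ μ(A u)`). [folklore] -/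
theorem mul_measureReal_le_sum_of_indicator {Ω ι : Type*} [MeasurableSpace Ω] (μ : Measure Ω)
    [IsFiniteMeasure μ] (F : Finset ι) (A : ι → Set Ω) (hA : ∀ u ∈ F, MeasurableSet (A u))
    {a : ℝ} (ha : 0 ≤ a) :
    a * μ.real {ω | a ≤ ∑ u ∈ F, (A u).indicator (1 : Ω → ℝ) ω} ≤ ∑ u ∈ F, μ.real (A u) := by
  classical
  set f : Ω → ℝ≥0∞ := fun ω => ∑ u ∈ F, (A u).indicator 1 ω with hf
  have hf_eq : ∀ ω, f ω = ((F.filter fun u => ω ∈ A u).card : ℝ≥0∞) := by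
    intro ω
    rw [hf, Finset.card_filter, Nat.cast_sum]
    refine Finset.sum_congr rfl fun u _ => ?_
    by_cases h : ω ∈ A u <;> simp [h]
  have hr_eq : ∀ ω, ∑ u ∈ F, (A u).indicator (1 : Ω → ℝ) ω =
      ((F.filter fun u => ω ∈ A u).card : ℝ) := by
    intro ω
    rw [Finset.card_filter, Nat.cast_sum]
    refine Finset.sum_congr rfl fun u _ => ?_
    by_cases h : ω ∈ A u <;> simp [h]
  have hmeas : Measurable f :=
    Finset.measurable_sum F fun u hu => measurable_one.indicator (hA u hu)
  have hlint : ∫⁻ ω, f ω ∂μ = ∑ u ∈ F, μ (A u) := by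
    rw [hf, lintegral_finsetSum F fun u hu => measurable_one.indicator (hA u hu)]
    exact Finset.sum_congr rfl fun u hu => lintegral_indicator_one (hA u hu)
  have hmarkov := mul_meas_ge_le_lintegral₀ (μ := μ) hmeas.aemeasurable (ENNReal.ofReal a)
  rw [hlint] at hmarkov
  have hset : {ω | ENNReal.ofReal a ≤ f ω} = {ω | a ≤ ∑ u ∈ F, (A u).indicator (1 : Ω → ℝ) ω} := by
    ext ω
    simp only [Set.mem_setOf_eq, hf_eq, hr_eq, ENNReal.ofReal_le_natCast]
  rw [hset] at hmarkov
  have hne : ∑ u ∈ F, μ (A u) ≠ ∞ := ENNReal.sum_ne_top.2 fun u _ => measure_ne_top μ _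
  have h := ENNReal.toReal_mono hne hmarkov
  rw [ENNReal.toReal_mul, ENNReal.toReal_ofReal ha,
    ENNReal.toReal_sum fun u _ => measure_ne_top μ _] at h
  simpa only [measureReal_def] using h

/-! ## The event `J(n, r, u)`: `u` is joined to the inner box inside `B(n + r)` -/

/-- `J(n, r, u)` is measurable (a finite union of the local events `{u ↔ x in B(n + r)}`). [folklore] -/
theorem measurableSet_setOf_joined (n r : ℕ) (u : Site 3) :
    MeasurableSet {ω : BondConfig (Site 3) |
      ∃ x ∈ box 3 n, ω ∈ openConnIn (↑(box 3 (n + r)) : Set (Site 3)) u x} := by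
  have : {ω : BondConfig (Site 3) | ∃ x ∈ box 3 n, ω ∈ openConnIn (↑(box 3 (n + r)) : Set (Site 3)) u x}
      = ⋃ x ∈ (↑(box 3 n) : Set (Site 3)), openConnIn (↑(box 3 (n + r)) : Set (Site 3)) u x := by
    ext ω
    simp only [Set.mem_setOf_eq, Set.mem_iUnion, exists_prop, Finset.mem_coe]
  rw [this]
  exact MeasurableSet.biUnion (Set.to_countable _) fun x _ => DCT16.measurableSet_openConnIn _ _ _

/-- A vertex of `B(n)` is joined to itself: `B(n) ⊆ W(ω)`. [folklore] -/
theorem joined_self {n r : ℕ} {x : Site 3} (hx : x ∈ box 3 n) (ω : BondConfig (Site 3)) :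
    ∃ x' ∈ box 3 n, ω ∈ openConnIn (↑(box 3 (n + r)) : Set (Site 3)) x x' :=
  have hx' : x ∈ (↑(box 3 (n + r)) : Set (Site 3)) :=
    Finset.mem_coe.2 (box_mono 3 (Nat.le_add_right n r) hx)
  ⟨x, hx, hx', hx', SimpleGraph.Reachable.refl _⟩

/-- A joined vertex lies in `B(n + r)`: `W(ω) ⊆ B(n + r)`. [folklore] -/
theorem mem_box_of_joined {n r : ℕ} {u : Site 3} {ω : BondConfig (Site 3)}
    (hu : ∃ x ∈ box 3 n, ω ∈ openConnIn (↑(box 3 (n + r)) : Set (Site 3)) u x) :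
    u ∈ box 3 (n + r) := by
  obtain ⟨x, -, hu, -, -⟩ := hu
  exact Finset.mem_coe.1 hu

/-- An open pair `{u, v}` with `u` joined and `v ∈ B(n + r)` makes `v` joined. [folklore] -/
theorem joined_of_adj {n r : ℕ} {u v : Site 3} {ω : BondConfig (Site 3)}
    (hu : ∃ x ∈ box 3 n, ω ∈ openConnIn (↑(box 3 (n + r)) : Set (Site 3)) u x)
    (hv : v ∈ box 3 (n + r)) (he : s(u, v) ∈ ω) (hne : u ≠ v) :
    ∃ x ∈ box 3 n, ω ∈ openConnIn (↑(box 3 (n + r)) : Set (Site 3)) v x := by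
  obtain ⟨x, hx, huS, hxS, hr⟩ := hu
  refine ⟨x, hx, Finset.mem_coe.2 hv, hxS, ?_⟩
  refine SimpleGraph.Reachable.trans (SimpleGraph.Adj.reachable ?_) hr
  rw [SimpleGraph.induce_adj, openGraph_adj]
  exact ⟨by rw [Sym2.eq_swap]; exact he, hne.symm⟩

/-- Transport by the face symmetry: if `s · u_i = -(n + r)` then `faceIso u i s` maps `B(n + r)` into
`ℍ = {0 ≤ x₀}`, `u` to `0` and `B(n)` to height `≥ r`, so `J(n, r, u)` is carried into `armH r`.
[folklore] -/
theorem setOf_joined_subset_preimage_armH {n r : ℕ} {u : Site 3} {i : Fin 3} {s : ℤˣ}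
    (hs1 : (s : ℤ) = 1 ∨ (s : ℤ) = -1) (hsu : (s : ℤ) * u i = -((n + r : ℕ) : ℤ)) :
    {ω : BondConfig (Site 3) | ∃ x ∈ box 3 n, ω ∈ openConnIn (↑(box 3 (n + r)) : Set (Site 3)) u x} ⊆
      BondConfig.relabel (sym2Equiv (faceIso u i s).toEquiv) ⁻¹' armH r := by
  rintro ω ⟨x, hx, hω⟩
  rw [Set.mem_preimage]
  have h1 := relabel_mem_openConnIn (faceIso u i s).toEquiv hω
  rw [faceIso_apply_self] at h1
  refine ⟨(faceIso u i s).toEquiv x, ⟨0, ?_⟩, openConnIn_mono ?_ _ _ h1⟩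
  · rw [faceIso_apply_zero]
    rw [mem_box] at hx
    obtain ⟨hx1, hx2⟩ := hx i
    rcases hs1 with h | h <;> rw [h] at hsu ⊢ <;> rw [le_abs] <;> left <;> omega
  · rintro _ ⟨z, hz, rfl⟩
    rw [Finset.mem_coe, mem_box] at hz
    change 0 ≤ (faceIso u i s).toEquiv z 0
    rw [faceIso_apply_zero]
    obtain ⟨hz1, hz2⟩ := hz i
    rcases hs1 with h | h <;> rw [h] at hsu ⊢ <;> omega

/-- **Symmetry bound** (translation and signed-coordinate-permutation invariance of `P_p`): for `u` on
the inner vertex boundary of `B(n + r)`, `P_p(J(n, r, u)) ≤ P_p(armH r)` — the "lattice symmetries"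
part of step (ii) of the item. [folklore] -/
theorem real_setOf_joined_le_armH (p : unitInterval) {n r : ℕ} {u : Site 3}
    (hu : u ∈ innerBoundary (zdGraph 3) (box 3 (n + r))) :
    (bondPercolation (zdGraph 3) p).real {ω : BondConfig (Site 3) |
        ∃ x ∈ box 3 n, ω ∈ openConnIn (↑(box 3 (n + r)) : Set (Site 3)) u x} ≤
      (bondPercolation (zdGraph 3) p).real (armH r) := by
  obtain ⟨i, hi⟩ := exists_eq_of_mem_innerBoundary_box hu
  obtain ⟨s, hs1, hsu⟩ : ∃ s : ℤˣ, ((s : ℤ) = 1 ∨ (s : ℤ) = -1) ∧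
      (s : ℤ) * u i = -((n + r : ℕ) : ℤ) := by
    rcases hi with h | h
    · exact ⟨-1, Or.inr (by simp), by rw [h]; simp⟩
    · exact ⟨1, Or.inl (by simp), by rw [h]; simp⟩
  rw [← bondPercolation_real_preimage_relabel_iso (faceIso u i s) p (armH r)]
  exact measureReal_mono (setOf_joined_subset_preimage_armH hs1 hsu) (measure_ne_top _ _)

/-! ## The Rossignol–Théret cutset and the first-moment bound -/

open Classical in
/-- **The Rossignol–Théret cutset of the annulus** (RT18 Prop. 3.9, Bernoulli case): for
`r + 1 ≤ n` and `ω ⊆ E(ℤ³)` there is a finite set `T` of pairs with `|T| ≤ 6 · N(ω)` whose closing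
leaves no open path inside `B(2n)` from `B(n)` to `∂ⁱⁿB(2n)` — namely the open edges `{u, v}` inside
`B(2n)` with `u ∈ W(ω)`, `v ∉ W(ω)` (see the module docstring for (a) the count and (b) the cutset
property). [cite: RossignolTheret2018, Prop. 3.9] -/
theorem exists_cutset {n r : ℕ} (hrn : r + 1 ≤ n) {ω : BondConfig (Site 3)}
    (hω : ω ⊆ (zdGraph 3).edgeSet) :
    ∃ T : Finset (Sym2 (Site 3)),
      (T.card : ℝ) ≤ 6 * ∑ u ∈ innerBoundary (zdGraph 3) (box 3 (n + r)),
        {ω' : BondConfig (Site 3) | ∃ x ∈ box 3 n,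
          ω' ∈ openConnIn (↑(box 3 (n + r)) : Set (Site 3)) u x}.indicator
            (1 : BondConfig (Site 3) → ℝ) ω ∧
      ¬ ∃ x ∈ box 3 n, ∃ y ∈ innerBoundary (zdGraph 3) (box 3 (2 * n)),
        (ω \ ↑T) ∈ openConnIn ↑(box 3 (2 * n)) x y := by
  -- `W u`: `u` is joined to `B(n)` inside `B(n + r)`
  let W : Site 3 → Prop := fun u =>
    ∃ x ∈ box 3 n, ω ∈ openConnIn (↑(box 3 (n + r)) : Set (Site 3)) u x
  -- the exploration set restricted to the boundary, and the cutset
  set Fω : Finset (Site 3) := (innerBoundary (zdGraph 3) (box 3 (n + r))).filter fun u => W u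
    with hFω
  set P : Finset (Site 3 × Site 3) := (box 3 (2 * n) ×ˢ box 3 (2 * n)).filter
    fun q : Site 3 × Site 3 => s(q.1, q.2) ∈ ω ∧ W q.1 ∧ ¬ W q.2 with hP
  refine ⟨P.image fun q => s(q.1, q.2), ?_, ?_⟩
  · -- (a) the count `|T| ≤ |P| ≤ 6 |Fω| = 6 N(ω)`
    set Q : Finset (Site 3 × Site 3) :=
      Fω.biUnion fun u => ((zdGraph 3).neighborFinset u).image fun v => (u, v) with hQ
    have hsub : P ⊆ Q := by
      rintro ⟨u, v⟩ hq
      rw [hP, Finset.mem_filter] at hq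
      obtain ⟨-, he, hu, hv⟩ := hq
      have hadj : (zdGraph 3).Adj u v := by simpa using hω he
      have hub : u ∈ box 3 (n + r) := mem_box_of_joined hu
      have hvb : v ∉ box 3 (n + r) := fun hvb => hv (joined_of_adj hu hvb he hadj.ne)
      have huF : u ∈ Fω := by
        rw [hFω, Finset.mem_filter, mem_innerBoundary_iff]
        exact ⟨⟨hub, v, hvb, hadj⟩, hu⟩
      rw [hQ, Finset.mem_biUnion]
      exact ⟨u, huF, Finset.mem_image.2 ⟨v, (SimpleGraph.mem_neighborFinset _ _ _).2 hadj, rfl⟩⟩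
    have hdeg : ∀ u : Site 3, ((zdGraph 3).neighborFinset u).card = 2 * 3 := by
      have h := card_neighborFinset_zdGraph_holds (d := 3)
      exact h
    have hnat : (P.image fun q => s(q.1, q.2)).card ≤ 6 * Fω.card :=
      calc (P.image fun q => s(q.1, q.2)).card ≤ P.card := Finset.card_image_le
        _ ≤ Q.card := Finset.card_le_card hsub
        _ ≤ ∑ u ∈ Fω, (((zdGraph 3).neighborFinset u).image fun v => (u, v)).card :=
            Finset.card_biUnion_le
        _ ≤ ∑ u ∈ Fω, 6 := Finset.sum_le_sum fun u _ =>
            Finset.card_image_le.trans (by rw [hdeg u])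
        _ = 6 * Fω.card := by rw [Finset.sum_const, smul_eq_mul, mul_comm]
    have hcount : (Fω.card : ℝ) = ∑ u ∈ innerBoundary (zdGraph 3) (box 3 (n + r)),
        {ω' : BondConfig (Site 3) | ∃ x ∈ box 3 n,
          ω' ∈ openConnIn (↑(box 3 (n + r)) : Set (Site 3)) u x}.indicator
            (1 : BondConfig (Site 3) → ℝ) ω := by
      rw [hFω, Finset.card_filter, Nat.cast_sum]
      refine Finset.sum_congr rfl fun u _ => ?_
      by_cases h : W u
      · rw [if_pos h, Set.indicator_of_mem (show ω ∈ {ω' : BondConfig (Site 3) | ∃ x ∈ box 3 n,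
          ω' ∈ openConnIn (↑(box 3 (n + r)) : Set (Site 3)) u x} from h), Pi.one_apply, Nat.cast_one]
      · rw [if_neg h, Set.indicator_of_notMem (show ω ∉ {ω' : BondConfig (Site 3) | ∃ x ∈ box 3 n,
          ω' ∈ openConnIn (↑(box 3 (n + r)) : Set (Site 3)) u x} from h), Nat.cast_zero]
    rw [← hcount]
    exact_mod_cast hnat
  · -- (b) the cutset property
    rintro ⟨x, hx, y, hy, hxS, hyS, ⟨p⟩⟩
    set WS : Set (↥(↑(box 3 (2 * n)) : Set (Site 3))) := {z | W z.1} with hWS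
    have hxP : (⟨x, hxS⟩ : ↥(↑(box 3 (2 * n)) : Set (Site 3))) ∈ WS := joined_self hx ω
    have hyP : (⟨y, hyS⟩ : ↥(↑(box 3 (2 * n)) : Set (Site 3))) ∉ WS := by
      intro hyP'
      have hyb : y ∈ box 3 (n + r) := mem_box_of_joined hyP'
      obtain ⟨i, hi⟩ := exists_eq_of_mem_innerBoundary_box hy
      rw [mem_box] at hyb
      obtain ⟨h1, h2⟩ := hyb i
      push_cast at hi h1 h2
      omega
    obtain ⟨d, -, hd1, hd2⟩ := p.exists_boundary_dart WS hxP hyP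
    have hadj := d.adj
    rw [SimpleGraph.induce_adj, openGraph_adj] at hadj
    obtain ⟨⟨hωd, hT⟩, -⟩ := hadj
    exact hT (Finset.mem_coe.2 (Finset.mem_image.2 ⟨(d.fst.1, d.snd.1),
      Finset.mem_filter.2 ⟨Finset.mem_product.2 ⟨d.fst.2, d.snd.2⟩, hωd, hd1, hd2⟩, rfl⟩))

/-- Off the budget event `{MinCut ≤ k}` and on `{ω ⊆ E(ℤ³)}`, many boundary vertices of `B(n + r)` are
joined to `B(n)`: `{MinCut ≤ k}ᶜ ⊆ {(k + 1) / 6 ≤ N} ∪ {ω ⊄ E(ℤ³)}` (`r + 1 ≤ n`), since otherwise the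
cutset of `exists_cutset` has at most `k` pairs (`minOpenCutIn_le_iff`). [cite: RossignolTheret2018, Prop. 3.9] -/
theorem compl_setOf_minOpenCutIn_le_subset {n r : ℕ} (hrn : r + 1 ≤ n) (k : ℕ) :
    {ω : BondConfig (Site 3) | minOpenCutIn (↑(box 3 (2 * n))) (↑(box 3 n))
        (↑(innerBoundary (zdGraph 3) (box 3 (2 * n)))) ω ≤ k}ᶜ ⊆
      {ω | ((k : ℝ) + 1) / 6 ≤ ∑ u ∈ innerBoundary (zdGraph 3) (box 3 (n + r)),
          {ω' : BondConfig (Site 3) | ∃ x ∈ box 3 n,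
            ω' ∈ openConnIn (↑(box 3 (n + r)) : Set (Site 3)) u x}.indicator
              (1 : BondConfig (Site 3) → ℝ) ω} ∪
        {ω | ¬ ω ⊆ (zdGraph 3).edgeSet} := by
  intro ω hω
  by_cases hG : ω ⊆ (zdGraph 3).edgeSet
  · left
    rw [Set.mem_setOf_eq]
    by_contra hlt
    push Not at hlt
    apply hω
    obtain ⟨T, hT, hcut⟩ := exists_cutset hrn hG
    rw [Set.mem_setOf_eq, minOpenCutIn_le_iff]
    refine ⟨T, ?_, hcut⟩
    have h1 : (T.card : ℝ) < k + 1 := by linarith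
    have h2 : T.card < k + 1 := by exact_mod_cast h1
    omega
  · right
    exact hG

/-- **Main estimate** (cutset, counting, symmetry, Markov, `|∂ⁱⁿB(n + r)| ≤ 6 (2(n+r)+1)² ≤ 96 n²`):
for every `p`, every `k` and `r + 1 ≤ n`,
`P_p(MinCut_{B(2n)}(B(n), ∂ⁱⁿB(2n)) > k) ≤ 576 n² / (k + 1) · P_p(armH r)` — the probability that the
annulus cannot be blocked by closing at most `k` edges is controlled by the half-space one-arm
probability to distance `r`. [cite: RossignolTheret2018, Prop. 3.9] -/
theorem real_compl_setOf_minOpenCutIn_le (p : unitInterval) {n r : ℕ} (hrn : r + 1 ≤ n) (k : ℕ) :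
    (bondPercolation (zdGraph 3) p).real {ω : BondConfig (Site 3) |
        minOpenCutIn (↑(box 3 (2 * n))) (↑(box 3 n))
          (↑(innerBoundary (zdGraph 3) (box 3 (2 * n)))) ω ≤ k}ᶜ ≤
      576 * (n : ℝ) ^ 2 / ((k : ℝ) + 1) * (bondPercolation (zdGraph 3) p).real (armH r) := by
  set μ := bondPercolation (zdGraph 3) p with hμ
  set Fm := innerBoundary (zdGraph 3) (box 3 (n + r)) with hFm
  set J : Site 3 → Set (BondConfig (Site 3)) := fun u => {ω' : BondConfig (Site 3) | ∃ x ∈ box 3 n,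
      ω' ∈ openConnIn (↑(box 3 (n + r)) : Set (Site 3)) u x} with hJ
  -- the Markov event `{(k + 1) / 6 ≤ N}` and the null event `{ω ⊄ E(ℤ³)}`
  set M : Set (BondConfig (Site 3)) :=
    {ω | ((k : ℝ) + 1) / 6 ≤ ∑ u ∈ Fm, (J u).indicator (1 : BondConfig (Site 3) → ℝ) ω} with hM
  set Bad : Set (BondConfig (Site 3)) := {ω | ¬ ω ⊆ (zdGraph 3).edgeSet} with hBad
  have ha : 0 < ((k : ℝ) + 1) / 6 := by positivity
  have hg : 0 ≤ μ.real (armH r) := measureReal_nonneg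
  have hbad : μ.real Bad = 0 := by
    have hae : ∀ᵐ ω ∂μ, ω ⊆ (zdGraph 3).edgeSet := ProbabilityTheory.setBernoulli_ae_subset
    rw [measureReal_def, ENNReal.toReal_eq_zero_iff]
    left
    exact ae_iff.1 hae
  have hmarkov : ((k : ℝ) + 1) / 6 * μ.real M ≤ ∑ u ∈ Fm, μ.real (J u) :=
    mul_measureReal_le_sum_of_indicator μ Fm J (fun u _ => measurableSet_setOf_joined n r u) ha.le
  have hsum : ∑ u ∈ Fm, μ.real (J u) ≤ Fm.card * μ.real (armH r) := by
    calc ∑ u ∈ Fm, μ.real (J u) ≤ ∑ u ∈ Fm, μ.real (armH r) :=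
          Finset.sum_le_sum fun u hu => real_setOf_joined_le_armH _ hu
      _ = Fm.card * μ.real (armH r) := by rw [Finset.sum_const, nsmul_eq_mul]
  have hcard : (Fm.card : ℝ) ≤ 96 * (n : ℝ) ^ 2 := by
    have h1 : Fm.card ≤ 2 * 3 * (2 * (n + r) + 1) ^ (3 - 1) := card_innerBoundary_box_le (n + r)
    have h2 : 2 * (n + r) + 1 ≤ 4 * n := by omega
    have h3 : Fm.card ≤ 96 * n ^ 2 := by
      calc Fm.card ≤ 6 * (2 * (n + r) + 1) ^ 2 := by simpa using h1
        _ ≤ 6 * (4 * n) ^ 2 := by gcongr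
        _ = 96 * n ^ 2 := by ring
    exact_mod_cast h3
  have hP : μ.real M ≤ 96 * (n : ℝ) ^ 2 * μ.real (armH r) / (((k : ℝ) + 1) / 6) := by
    rw [le_div_iff₀ ha]
    calc μ.real M * (((k : ℝ) + 1) / 6) = ((k : ℝ) + 1) / 6 * μ.real M := mul_comm _ _
      _ ≤ ∑ u ∈ Fm, μ.real (J u) := hmarkov
      _ ≤ Fm.card * μ.real (armH r) := hsum
      _ ≤ 96 * (n : ℝ) ^ 2 * μ.real (armH r) := by gcongr
  have hsub := compl_setOf_minOpenCutIn_le_subset hrn k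
  calc μ.real {ω : BondConfig (Site 3) | minOpenCutIn (↑(box 3 (2 * n))) (↑(box 3 n))
          (↑(innerBoundary (zdGraph 3) (box 3 (2 * n)))) ω ≤ k}ᶜ
      ≤ μ.real (M ∪ Bad) := measureReal_mono hsub (measure_ne_top _ _)
    _ ≤ μ.real M + μ.real Bad := measureReal_union_le _ _
    _ = μ.real M := by rw [hbad, add_zero]
    _ ≤ 96 * (n : ℝ) ^ 2 * μ.real (armH r) / (((k : ℝ) + 1) / 6) := hP
    _ = 576 * (n : ℝ) ^ 2 / ((k : ℝ) + 1) * μ.real (armH r) := by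
        field_simp
        ring

end PercBudgetLadderZhangBase

end Summit.CriticalPhenomena.PercolationContinuityZ3.Theorems

end
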